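import Mathlib.AlgebraicGeometry.Gluing
import Mathlib.AlgebraicGeometry.Restrict
import HarnessLib

/-!
# Glue data from open subschemes, transition maps and a point-free cocycle

[StacksProject, Tag 01JA] (glueing schemes; [GortzWedhorn2020] Def. 3.9 / Prop. 3.10; Hartshorne II Ex. 2.12): «a family
of schemes `Xᵢ`, opens `Uᵢⱼ ⊆ Xᵢ` with `Uᵢᵢ = Xᵢ`, isomorphisms `φᵢⱼ : Uᵢⱼ → Uⱼᵢ` with `φᵢᵢ = id`,
`φᵢⱼ(Uᵢⱼ ∩ Uᵢₖ) = Uⱼᵢ ∩ Uⱼₖ` and the cocycle `φᵢₖ = φⱼₖ ∘ φᵢⱼ` on `Uᵢⱼ ∩ Uᵢₖ` glue to a scheme `X = ⋃ Xᵢ`».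

Mathlib's `AlgebraicGeometry.Scheme.GlueData` asks for this datum in PULL-BACK form: transition maps on `V i j`, a SECOND
family `t' i j k : V i j ×_{U i} V i k ⟶ V j k ×_{U j} V j i` and the cocycle `t' i j k ≫ t' j k i ≫ t' k i j = 𝟙` on
iterated pull-backs (`CategoryTheory.GlueData'` keeps that shape).  THIS FILE supplies the textbook constructor: from an
`OpensGlueDatum` — charts `U i`, OPENS `W i j ⊆ U i` with `W i i = ⊤`, transition morphisms `t i j : W i j ⟶ U j` (into the
ambient chart, `t i i` the inclusion) landing in `W j i` (`t_mem`), mapping `W i j ∩ W i k` into `W j k` (`dom`), and the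
cocycle `t j k ∘ t i j = t i k` stated, as in ★ `RelativeSpec.TransitionAtlasGluing.TransitionAtlas` (one chart glued to
itself), against TEST MORPHISMS from opens of `U i` so that no proof term enters the statement — it builds
`OpensGlueDatum.glueData : Scheme.GlueData` with `J`, `U`, `V (i, j) := W i j`, `f i j := (W i j).ι` DEFINITIONALLY, the
transition maps the factorisations of the `t i j` through `W j i` (`glueData_t_ι`), the `t'` transported from the lifts
`tTriple i j k : W i j ⊓ W i k ⟶ W j k ⊓ W j i` along Mathlib's `isPullback_opens_inf`, and `t_fac`, `cocycle`, `f_id` PROVED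
(§2; the pull-back cocycle is the test-morphism cocycle used twice, read through the monomorphism `W i j ⊓ W i k ⟶ U i`).
§3 reads Mathlib's API on the result: the glue relation `t i j ≫ ι j = (W i j).ι ≫ ι i` (`t_ι`), the EXACT point
identification `ι i x = ι j y ↔ ∃ hx : x ∈ W i j, t i j ⟨x, hx⟩ = y` (`ι_eq_ι_iff`), `t j i (t i j x) = x` (`t_t_self_apply`).
So ★ `GlueDataOverBase` (morphisms to / between glued schemes, cartesian charts), ★ `GlueDataRelative` (families over the
glued scheme) and ★ `AbelianSchemes/AbelianSchemeOverGlueData` apply BY NAME to a scheme presented by open subschemes and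
transition maps — the shape in which a quotient-by-slices `A⁰ := ⋃ V_R` (slices `V_R`, opens `V_R ∩ U_{R'}`, transition
«the unique projectivity between two frames», [MumfordFogartyKirwan1994] Prop. 7.6) arises.

One `structure`, three `def`s (`tLift`, `tTriple`, `glueData`), the rest theorems; no named fact, no `sorry`, no instance.
Cell hodgecm-mathlib, F-DAG price sheet §5b hand (h7) «Zariski gluing of `S`-objects from a cocycle», FILE 2c (the base glue
datum); consumer leaf F-8 (8c).  HC_CM is proved only modulo the printed citations until rung 0 closes; this file discharges
none of them.

## References
* [StacksProject] The Stacks Project, Tag 01JA (Glueing schemes).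
* [GortzWedhorn2020] U. Görtz, T. Wedhorn, *Algebraic Geometry I*, 2nd ed. (2020), Section (3.5) Def. 3.9 (gluing datum),
  Prop. 3.10 (gluing of schemes; «`ψᵢ(Uᵢ) ∩ ψⱼ(Uⱼ) = ψᵢ(Uᵢⱼ)`»).
* [Hartshorne1977] R. Hartshorne, *Algebraic Geometry* (1977), II Ex. 2.12 (Glueing Lemma).
-/

noncomputable section

universe u

open CategoryTheory CategoryTheory.Limits AlgebraicGeometry TopologicalSpace

namespace Literature.AlgebraicGeometry.Morphisms

/-- **A gluing datum given by open subschemes and transition maps** ([StacksProject, Tag 01JA]; [GortzWedhorn2020]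
Def. 3.9; [Hartshorne1977] II Ex. 2.12): charts `U i`, opens `W i j ⊆ U i` («the part of chart `i` meeting chart `j`»,
`W i i = ⊤`), transition morphisms `t i j : W i j ⟶ U j` INTO THE AMBIENT CHART (`t i i` = the inclusion) with
`t i j (W i j) ⊆ W j i` (`t_mem`) and `t i j (W i j ∩ W i k) ⊆ W j k` (`dom`), and the cocycle `t j k ∘ t i j = t i k` as an
equality of MORPHISMS `O ⟶ U k` for every open `O ⊆ U i` and all test morphisms `a : O ⟶ W i j`, `b : O ⟶ W j k`,
`c : O ⟶ W i k` over the inclusions (so that no membership proof enters the statement; with `k = i` it contains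
`t j i ∘ t i j = id`). [cite: StacksProject, Tag 01JA] [cite: GortzWedhorn2020, Section (3.5) Definition 3.9]
[cite: Hartshorne1977, II Ex. 2.12] -/
structure OpensGlueDatum where
  /-- The index type of the charts. -/
  J : Type u
  /-- The charts. -/
  U : J → Scheme.{u}
  /-- `W i j ⊆ U i`: the part of chart `i` glued to chart `j`. -/
  W : ∀ i j : J, (U i).Opens
  /-- The transition morphism `t i j : W i j ⟶ U j` (lands in `W j i`). -/
  t : ∀ i j : J, (W i j : Scheme.{u}) ⟶ U j
  /-- Chart `i` is glued to itself along all of `U i`. -/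
  W_self : ∀ i, W i i = ⊤
  /-- The self-transition is the inclusion `W i i ⟶ U i`. -/
  t_self : ∀ i, t i i = (W i i).ι
  /-- `t i j (W i j) ⊆ W j i`. -/
  t_mem : ∀ i j (x : W i j), t i j x ∈ W j i
  /-- `t i j (W i j ∩ W i k) ⊆ W j k`. -/
  dom : ∀ i j k (x : W i j), x.1 ∈ W i k → t i j x ∈ W j k
  /-- The cocycle `t j k ∘ t i j = t i k` on `W i j ∩ W i k`, against test morphisms `a b c` over the inclusions. -/
  cocycle : ∀ i j k (O : (U i).Opens) (a : (O : Scheme.{u}) ⟶ W i j) (b : (O : Scheme.{u}) ⟶ W j k)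
    (c : (O : Scheme.{u}) ⟶ W i k), a ≫ (W i j).ι = O.ι → b ≫ (W j k).ι = a ≫ t i j → c ≫ (W i k).ι = O.ι →
    b ≫ t j k = c ≫ t i k

namespace OpensGlueDatum

variable (𝒟 : OpensGlueDatum.{u})

/-! ### §1 The transition maps between the opens and their lifts to the triple overlaps -/

/-- The transition map FACTORED THROUGH ITS TARGET OPEN: `tLift i j : W i j ⟶ W j i` with `tLift i j ≫ (W j i).ι = t i j`
(Mathlib `IsOpenImmersion.lift`, by `t_mem`). [cite: StacksProject, Tag 01JA] -/
def tLift (i j : 𝒟.J) : (𝒟.W i j : Scheme.{u}) ⟶ 𝒟.W j i :=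
  IsOpenImmersion.lift (𝒟.W j i).ι (𝒟.t i j) (by
    rw [Scheme.Opens.range_ι]
    rintro _ ⟨x, rfl⟩
    exact 𝒟.t_mem i j x)

/-- `tLift i j` lies over `t i j`. [cite: StacksProject, Tag 01JA] -/
theorem tLift_ι (i j : 𝒟.J) : 𝒟.tLift i j ≫ (𝒟.W j i).ι = 𝒟.t i j :=
  IsOpenImmersion.lift_fac _ _ _

/-- `tLift i i = 𝟙` (from `t i i = (W i i).ι`). [cite: StacksProject, Tag 01JA] -/
theorem tLift_self (i : 𝒟.J) : 𝒟.tLift i i = 𝟙 _ := by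
  rw [← cancel_mono (𝒟.W i i).ι, tLift_ι, 𝒟.t_self, Category.id_comp]

/-- Pointwise form of `tLift`: `(tLift i j x).1 = t i j x`. [cite: StacksProject, Tag 01JA] -/
theorem tLift_apply_coe (i j : 𝒟.J) (x : 𝒟.W i j) : ((𝒟.tLift i j) x).1 = 𝒟.t i j x := by
  change (𝒟.W j i).ι ((𝒟.tLift i j) x) = _
  rw [← Scheme.Hom.comp_apply, tLift_ι]

/-- The transition map on TRIPLE overlaps: the lift `tTriple i j k : W i j ⊓ W i k ⟶ W j k ⊓ W j i` of
`t i j` restricted to `W i j ∩ W i k` (exists by `dom` and `t_mem`; Mathlib `IsOpenImmersion.lift`). It plays the rôle of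
Mathlib's `GlueData.t'` once the intersections are identified with the pull-backs. [cite: StacksProject, Tag 01JA]
[cite: GortzWedhorn2020, Section (3.5) Definition 3.9] -/
def tTriple (i j k : 𝒟.J) :
    ((𝒟.W i j ⊓ 𝒟.W i k : (𝒟.U i).Opens) : Scheme.{u}) ⟶ (𝒟.W j k ⊓ 𝒟.W j i : (𝒟.U j).Opens) :=
  IsOpenImmersion.lift (𝒟.W j k ⊓ 𝒟.W j i).ι ((𝒟.U i).homOfLE inf_le_left ≫ 𝒟.t i j) (by
    rw [Scheme.Opens.range_ι]
    rintro _ ⟨⟨x, hx₁, hx₂⟩, rfl⟩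
    rw [Scheme.Hom.comp_apply, Scheme.homOfLE_apply']
    exact ⟨𝒟.dom i j k ⟨x, hx₁⟩ hx₂, 𝒟.t_mem i j ⟨x, hx₁⟩⟩)

/-- `tTriple i j k` lies over `t i j`: `tTriple i j k ≫ (W j k ⊓ W j i).ι = (W i j ⊓ W i k ⟶ W i j) ≫ t i j`.
[cite: StacksProject, Tag 01JA] -/
theorem tTriple_ι (i j k : 𝒟.J) :
    𝒟.tTriple i j k ≫ (𝒟.W j k ⊓ 𝒟.W j i).ι = (𝒟.U i).homOfLE inf_le_left ≫ 𝒟.t i j :=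
  IsOpenImmersion.lift_fac _ _ _

/-- `tTriple i j k` lies over `tLift i j` (the `t_fac` axiom of the glue datum, before transport to pull-backs):
its `W j i`-component is `(W i j ⊓ W i k ⟶ W i j) ≫ tLift i j`. [cite: StacksProject, Tag 01JA] -/
theorem tTriple_snd (i j k : 𝒟.J) :
    𝒟.tTriple i j k ≫ (𝒟.U j).homOfLE inf_le_right = (𝒟.U i).homOfLE inf_le_left ≫ 𝒟.tLift i j := by
  rw [← cancel_mono (𝒟.W j i).ι, Category.assoc, Scheme.homOfLE_ι, tTriple_ι, Category.assoc, tLift_ι]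

/-- **Inverse transitions**: `tLift i j ≫ t j i` is the inclusion `W i j ⟶ U i` — the test-morphism cocycle at `(i, j, i)`
with `t i i` the inclusion ([StacksProject, Tag 01JA]: `φⱼᵢ = φᵢⱼ⁻¹`). [cite: StacksProject, Tag 01JA] -/
theorem tLift_t (i j : 𝒟.J) : 𝒟.tLift i j ≫ 𝒟.t j i = (𝒟.W i j).ι := by
  have hle : 𝒟.W i j ≤ 𝒟.W i i := by rw [𝒟.W_self]; exact le_top
  have h := 𝒟.cocycle i j i (𝒟.W i j) (𝟙 _) (𝒟.tLift i j) ((𝒟.U i).homOfLE hle) (Category.id_comp _)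
    (by rw [tLift_ι, Category.id_comp]) (Scheme.homOfLE_ι _ _)
  rw [h, 𝒟.t_self, Scheme.homOfLE_ι]

/-- **The cocycle on triple overlaps** ([StacksProject, Tag 01JA]: `φᵢₖ = φⱼₖ ∘ φᵢⱼ` on `Uᵢⱼ ∩ Uᵢₖ`, hence
`φₖᵢ ∘ φⱼₖ ∘ φᵢⱼ = id` there): `tTriple i j k ≫ tTriple j k i ≫ tTriple k i j = 𝟙` — the test-morphism cocycle at
`(j, k, i)` gives `t k i ∘ t j k ∘ t i j = t j i ∘ t i j` on `W i j ∩ W i k`, and `t j i ∘ t i j` is the inclusion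
(`tLift_t`); compare through the monomorphism `W i j ⊓ W i k ⟶ U i`. [cite: StacksProject, Tag 01JA]
[cite: GortzWedhorn2020, Section (3.5) Definition 3.9] -/
theorem tTriple_cocycle (i j k : 𝒟.J) : 𝒟.tTriple i j k ≫ 𝒟.tTriple j k i ≫ 𝒟.tTriple k i j = 𝟙 _ := by
  rw [← cancel_mono (𝒟.W i j ⊓ 𝒟.W i k).ι, Category.assoc, Category.assoc, tTriple_ι, Category.id_comp]
  -- cocycle at `(j, k, i)` on `O := W j k ⊓ W j i`
  have h₁ : (𝒟.tTriple j k i ≫ (𝒟.U k).homOfLE inf_le_left) ≫ 𝒟.t k i =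
      (𝒟.U j).homOfLE inf_le_right ≫ 𝒟.t j i :=
    𝒟.cocycle j k i (𝒟.W j k ⊓ 𝒟.W j i) ((𝒟.U j).homOfLE inf_le_left)
      (𝒟.tTriple j k i ≫ (𝒟.U k).homOfLE inf_le_left) ((𝒟.U j).homOfLE inf_le_right)
      (Scheme.homOfLE_ι _ _) (by rw [Category.assoc, Scheme.homOfLE_ι, tTriple_ι]) (Scheme.homOfLE_ι _ _)
  rw [Category.assoc] at h₁
  rw [h₁, ← Category.assoc, tTriple_snd, Category.assoc, tLift_t, Scheme.homOfLE_ι]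

/-! ### §2 The glue datum -/

/-- **The glue datum of an `OpensGlueDatum`** ([StacksProject, Tag 01JA]; [GortzWedhorn2020] Def. 3.9): charts `U i`,
overlaps `V (i, j) := W i j` with `f i j := (W i j).ι` (open immersions; `f i i` an isomorphism as `W i i = ⊤`),
transition maps `tLift i j`, triple-overlap maps `tTriple i j k` transported along Mathlib's
`isPullback_opens_inf : W i j ⊓ W i k = W i j ×_{U i} W i k`, `t_fac` and `cocycle` from §1.  Built with the
`Scheme.GlueData` constructor directly (`@[implicit_reducible]`, so that `glueData.U i` unfolds to `U i` during implicit-argument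
unification). [cite: StacksProject, Tag 01JA] [cite: GortzWedhorn2020, Section (3.5) Definition 3.9] -/
@[implicit_reducible]
def glueData : Scheme.GlueData.{u} where
  J := 𝒟.J
  U := 𝒟.U
  V ij := (𝒟.W ij.1 ij.2 : Scheme.{u})
  f i j := (𝒟.W i j).ι
  f_id i := isIso_of_isOpenImmersion_of_opensRange_eq_top _ (by rw [Scheme.Opens.opensRange_ι, 𝒟.W_self])
  t i j := 𝒟.tLift i j
  t_id i := 𝒟.tLift_self i
  t' i j k := (isPullback_opens_inf (𝒟.W i j) (𝒟.W i k)).isoPullback.inv ≫ 𝒟.tTriple i j k ≫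
    (isPullback_opens_inf (𝒟.W j k) (𝒟.W j i)).isoPullback.hom
  t_fac i j k := by
    rw [Category.assoc, Category.assoc, IsPullback.isoPullback_hom_snd, tTriple_snd,
      IsPullback.isoPullback_inv_fst_assoc]
  cocycle i j k := by
    simp only [Category.assoc, Iso.hom_inv_id_assoc]
    rw [reassoc_of% (𝒟.tTriple_cocycle i j k), Iso.inv_hom_id]
  f_open _ _ := inferInstance

/-- The index type of the glue datum. [cite: StacksProject, Tag 01JA] -/
theorem glueData_J : 𝒟.glueData.J = 𝒟.J := rfl

/-- The charts of the glue datum are the `U i`. [cite: StacksProject, Tag 01JA] -/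
theorem glueData_U (i : 𝒟.J) : 𝒟.glueData.U i = 𝒟.U i := rfl

/-- The overlaps of the glue datum are the opens `W i j`. [cite: StacksProject, Tag 01JA] -/
theorem glueData_V (i j : 𝒟.J) : 𝒟.glueData.V (i, j) = (𝒟.W i j : Scheme.{u}) := rfl

/-- The overlap inclusions of the glue datum are the `(W i j).ι`. [cite: StacksProject, Tag 01JA] -/
theorem glueData_f (i j : 𝒟.J) : 𝒟.glueData.f i j = (𝒟.W i j).ι := rfl

/-- The transition maps of the glue datum are the `tLift i j`. [cite: StacksProject, Tag 01JA] -/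
theorem glueData_t (i j : 𝒟.J) : 𝒟.glueData.t i j = 𝒟.tLift i j := rfl

/-- The transition maps of the glue datum lie over the given `t i j`. [cite: StacksProject, Tag 01JA] -/
theorem glueData_t_ι (i j : 𝒟.J) : 𝒟.glueData.t i j ≫ (𝒟.W j i).ι = 𝒟.t i j := 𝒟.tLift_ι i j

/-- The triple-overlap maps of the glue datum are the `tTriple i j k` transported to the pull-backs.
[cite: StacksProject, Tag 01JA] -/
theorem glueData_t' (i j k : 𝒟.J) :
    𝒟.glueData.t' i j k = (isPullback_opens_inf (𝒟.W i j) (𝒟.W i k)).isoPullback.inv ≫ 𝒟.tTriple i j k ≫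
      (isPullback_opens_inf (𝒟.W j k) (𝒟.W j i)).isoPullback.hom := rfl

/-! ### §3 The glued scheme: glue relation and point identification -/

/-- **The glue relation on the glued scheme** ([GortzWedhorn2020] Prop. 3.10: «`ψⱼ ∘ φᵢⱼ = ψᵢ` on `Uᵢⱼ`»):
`t i j ≫ ι j = (W i j).ι ≫ ι i` (Mathlib `Scheme.GlueData.glue_condition`).
[cite: GortzWedhorn2020, Section (3.5) Proposition 3.10] [cite: StacksProject, Tag 01JA] -/
theorem t_ι (i j : 𝒟.J) : 𝒟.t i j ≫ 𝒟.glueData.ι j = (𝒟.W i j).ι ≫ 𝒟.glueData.ι i := by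
  rw [← tLift_ι, Category.assoc]
  exact 𝒟.glueData.glue_condition i j

/-- `tLift i j ≫ tLift j i = 𝟙` (Mathlib `GlueData.t_inv` on the glue datum). [cite: StacksProject, Tag 01JA] -/
theorem tLift_tLift (i j : 𝒟.J) : 𝒟.tLift i j ≫ 𝒟.tLift j i = 𝟙 _ :=
  𝒟.glueData.t_inv i j

/-- Pointwise inverse transitions: `t j i (t i j x) = x`. [cite: StacksProject, Tag 01JA] -/
theorem t_t_self_apply (i j : 𝒟.J) (x : 𝒟.W i j) : 𝒟.t j i ⟨𝒟.t i j x, 𝒟.t_mem i j x⟩ = x.1 := by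
  have e : (⟨𝒟.t i j x, 𝒟.t_mem i j x⟩ : ↥(𝒟.W j i)) = 𝒟.tLift i j x := Subtype.ext (𝒟.tLift_apply_coe i j x).symm
  rw [e, ← Scheme.Hom.comp_apply, tLift_t, Scheme.Opens.ι_apply]

/-- `x ∈ W i j ⟹ (t i j x ∈ W j k ⟺ x ∈ W i k)` ([StacksProject, Tag 01JA]: «`φᵢⱼ(Uᵢⱼ ∩ Uᵢₖ) = Uⱼᵢ ∩ Uⱼₖ`»).
[cite: StacksProject, Tag 01JA] -/
theorem t_mem_iff (i j k : 𝒟.J) (x : 𝒟.W i j) : 𝒟.t i j x ∈ 𝒟.W j k ↔ x.1 ∈ 𝒟.W i k := by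
  refine ⟨fun h => ?_, 𝒟.dom i j k x⟩
  have h' := 𝒟.dom j i k ⟨𝒟.t i j x, 𝒟.t_mem i j x⟩ h
  rwa [t_t_self_apply] at h'

/-- **Exact point identification on the glued scheme** ([GortzWedhorn2020] Prop. 3.10; Mathlib
`Scheme.GlueData.ι_eq_iff`): `ι i x = ι j y ↔ ∃ hx : x ∈ W i j, t i j ⟨x, hx⟩ = y`.
[cite: GortzWedhorn2020, Section (3.5) Proposition 3.10] [cite: StacksProject, Tag 01JA] -/
theorem ι_eq_ι_iff (i j : 𝒟.J) (x : 𝒟.U i) (y : 𝒟.U j) :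
    𝒟.glueData.ι i x = 𝒟.glueData.ι j y ↔ ∃ hx : x ∈ 𝒟.W i j, 𝒟.t i j ⟨x, hx⟩ = y := by
  rw [𝒟.glueData.ι_eq_iff]
  change (∃ z : ↥(𝒟.W i j), (𝒟.W i j).ι z = x ∧ (𝒟.tLift i j ≫ (𝒟.W j i).ι) z = y) ↔ _
  rw [tLift_ι]
  constructor
  · rintro ⟨z, hz, hz'⟩
    rw [Scheme.Opens.ι_apply] at hz
    subst hz
    exact ⟨z.2, hz'⟩
  · rintro ⟨hx, h⟩
    exact ⟨⟨x, hx⟩, rfl, h⟩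

/-- The charts `ι i : U i ⟶ glued` cover the glued scheme, and a point of the glued scheme in the image of chart `j` comes
from `W j i ⊆ U j` iff it lies in the image of chart `i` (★ `GlueDataOverBase.glueData_preimage_range_ι` read on opens):
`(ι j)⁻¹(ι i (U i)) = W j i`. [cite: GortzWedhorn2020, Section (3.5) Proposition 3.10] [cite: StacksProject, Tag 01JA] -/
theorem preimage_range_ι (i j : 𝒟.J) :
    (𝒟.glueData.ι j) ⁻¹' Set.range (𝒟.glueData.ι i) = (𝒟.W j i : Set (𝒟.U j)) := by
  ext y
  constructor
  · rintro ⟨x, hx⟩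
    obtain ⟨hx', e⟩ := (𝒟.ι_eq_ι_iff i j x y).mp hx
    rw [← e]
    exact 𝒟.t_mem i j ⟨x, hx'⟩
  · intro hy
    refine ⟨𝒟.t j i ⟨y, hy⟩, (𝒟.ι_eq_ι_iff i j _ y).mpr ⟨𝒟.t_mem j i ⟨y, hy⟩, 𝒟.t_t_self_apply j i ⟨y, hy⟩⟩⟩

end OpensGlueDatum

end Literature.AlgebraicGeometry.Morphisms

end
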